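import Mathlib
import HarnessLib
import Summits.FinalStateConjecture.Statement
import Literature.Geometry.Lorentzian.LandauLifshitzPseudotensor

/-!
# Route EIHFluxBalance — crux `InertialRecession`, line `sublinear-is-free-clean-window-charges`:
# basics for the endgame stub `stub_cesaroEndgame` (part 1)

Helper file for the crux `stmt-FinalStateConjecture-10166`
(`Summit.FinalStateConjecture.FinalStateConjecture.Theses.EIHFluxBalance.InertialRecession`), registered stub
`stub_cesaroEndgame` of the line skeleton `Cruxes/InertialRecession/Lines/sublinear-is-free-clean-window-charges.lean`
(lead reshape r2): abstract window charges ⇒ Cesàro velocities. This file collects the Mathlib-only real analysis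
used by every case of the endgame:

* Cesàro velocities from slaved, convergent velocities (`tendsto_inv_smul_of_tendsto_deriv`,
  `tendsto_inv_smul_of_slaved`);
* a Cauchy criterion along `atTop` for real paths with a vanishing modulus (`exists_tendsto_of_abs_sub_le`);
* the impulse integral `∫_{t₁}^{t₂} (c s)^{-3/2} ds ≤ 2 c^{-3/2} t₁^{-1/2}` (`integral_inv_rpow_three_halves_le`);
* componentwise convergence in `E3` (`tendsto_euclidean_of_forall_apply`);
* recovery of the velocity from a convergent energy–momentum pair `(Mγ(v), Mγ(v)v)` (`tendsto_velocity_of_charge`).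

References: C. Marchal, D. Saari, J. Differential Equations 20 (1976) 150–186 (final evolution of the `N`-body
problem: the role of Cesàro velocities); B. O'Neill, Semi-Riemannian Geometry (1983), Ch. 9 (Lorentz factor).
-/

noncomputable section

set_option linter.dupNamespace false

open Filter Topology Set MeasureTheory intervalIntegral
open scoped Topology

namespace Summit.FinalStateConjecture.FinalStateConjecture.Theorems.SublinearIsFree.Endgame

open Literature.Geometry.Lorentzian

/-! ### Cesàro velocities from convergent velocities -/

/-- If `f : ℝ → E3` is differentiable and `f′(t) → V` as `t → ∞`, then `f(t)/t → V` (mean-value inequality on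
`[T₁, t]` applied to `f − (·)•V`). Adapted from the planner skeleton `Lines/old-light-leaves-the-cone.lean`
(same statement and proof). [folklore] -/
theorem tendsto_inv_smul_of_tendsto_deriv {f : ℝ → E3} {V : E3} (hf : Differentiable ℝ f)
    (h : Tendsto (deriv f) atTop (𝓝 V)) :
    Tendsto (fun t : ℝ ↦ t⁻¹ • f t) atTop (𝓝 V) := by
  rw [Metric.tendsto_atTop] at h ⊢
  intro ε hε
  obtain ⟨T₀, hT₀⟩ := h (ε / 2) (half_pos hε)
  obtain ⟨T₁, hT₁0, hT₁⟩ : ∃ T₁ : ℝ, 0 ≤ T₁ ∧ ∀ s, T₁ ≤ s → ‖deriv f s - V‖ < ε / 2 :=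
    ⟨max T₀ 0, le_max_right _ _, fun s hs ↦ by
      rw [← dist_eq_norm]; exact hT₀ s ((le_max_left _ _).trans hs)⟩
  have hgd : ∀ s, HasDerivAt (fun s : ℝ ↦ f s - s • V) (deriv f s - V) s := fun s ↦ by
    have h1 : HasDerivAt f (deriv f s) s := (hf s).hasDerivAt
    have h2 : HasDerivAt (fun s : ℝ ↦ s • V) ((1 : ℝ) • V) s := (hasDerivAt_id s).smul_const V
    have h3 := h1.sub h2
    rw [one_smul] at h3
    exact h3
  have hseg : ∀ t, T₁ ≤ t → ‖(f t - t • V) - (f T₁ - T₁ • V)‖ ≤ ε / 2 * (t - T₁) := by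
    intro t ht
    exact norm_image_sub_le_of_norm_deriv_le_segment' (f := fun s : ℝ ↦ f s - s • V) (a := T₁)
      (b := t) (fun s _ ↦ (hgd s).hasDerivWithinAt) (fun s hs ↦ le_of_lt (hT₁ s hs.1)) t
      (right_mem_Icc.mpr ht)
  refine ⟨max (T₁ + 1) (2 * ‖f T₁ - T₁ • V‖ / ε + 1), fun t ht ↦ ?_⟩
  have ht1 : T₁ + 1 ≤ t := (le_max_left _ _).trans ht
  have ht₁ : T₁ ≤ t := by linarith
  have htK : 2 * ‖f T₁ - T₁ • V‖ / ε + 1 ≤ t := (le_max_right _ _).trans ht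
  have htpos : 0 < t := by linarith
  have hKt : ‖f T₁ - T₁ • V‖ < ε / 2 * t := by
    have h1 : 2 * ‖f T₁ - T₁ • V‖ / ε < t := by linarith
    have h2 := (div_lt_iff₀ hε).mp h1
    linarith
  have hgt : ‖f t - t • V‖ ≤ ε / 2 * (t - T₁) + ‖f T₁ - T₁ • V‖ := by
    calc ‖f t - t • V‖ = ‖((f t - t • V) - (f T₁ - T₁ • V)) + (f T₁ - T₁ • V)‖ := by
          rw [sub_add_cancel]
      _ ≤ ‖(f t - t • V) - (f T₁ - T₁ • V)‖ + ‖f T₁ - T₁ • V‖ := norm_add_le _ _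
      _ ≤ ε / 2 * (t - T₁) + ‖f T₁ - T₁ • V‖ := by linarith [hseg t ht₁]
  have hgt' : ‖f t - t • V‖ < ε * t := by
    have hmono : ε / 2 * (t - T₁) ≤ ε / 2 * t :=
      mul_le_mul_of_nonneg_left (by linarith) (le_of_lt (half_pos hε))
    linarith
  have hid : t⁻¹ • f t - V = t⁻¹ • (f t - t • V) := by
    rw [smul_sub, smul_smul, inv_mul_cancel₀ htpos.ne', one_smul]
  rw [dist_eq_norm, hid, norm_smul, norm_inv, Real.norm_eq_abs, abs_of_pos htpos]
  calc t⁻¹ * ‖f t - t • V‖ < t⁻¹ * (ε * t) := mul_lt_mul_of_pos_left hgt' (inv_pos.mpr htpos)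
    _ = ε := by rw [mul_comm ε t, inv_mul_cancel_left₀ htpos.ne']

/-- SLAVED version: if `ξ` is differentiable, `ξ̇(t) − v(t) → 0` and `v(t) → V`, then `ξ(t)/t → V`. [folklore] -/
theorem tendsto_inv_smul_of_slaved {ξ v : ℝ → E3} {V : E3} (hξ : Differentiable ℝ ξ)
    (hslave : Tendsto (fun t ↦ deriv ξ t - v t) atTop (𝓝 0)) (hv : Tendsto v atTop (𝓝 V)) :
    Tendsto (fun t : ℝ ↦ t⁻¹ • ξ t) atTop (𝓝 V) := by
  refine tendsto_inv_smul_of_tendsto_deriv hξ ?_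
  have := hslave.add hv
  simpa using this

/-! ### A Cauchy criterion along `atTop` -/

/-- A real path whose increments after time `t₁` are bounded by `g(t₁)` with `g → 0` converges as `t → ∞`
(Cauchy criterion for the filter `atTop` on `ℝ`, complete). [folklore] -/
theorem exists_tendsto_of_abs_sub_le {f g : ℝ → ℝ} {T : ℝ} (hg : Tendsto g atTop (𝓝 0))
    (h : ∀ t₁ t₂, T ≤ t₁ → t₁ ≤ t₂ → |f t₂ - f t₁| ≤ g t₁) :
    ∃ L : ℝ, Tendsto f atTop (𝓝 L) := by
  have hc : Cauchy (map f atTop) := by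
    rw [Metric.cauchy_iff]
    refine ⟨map_neBot, fun ε hε ↦ ?_⟩
    obtain ⟨T₁, hT₁⟩ := (Metric.tendsto_atTop.mp hg) (ε / 2) (half_pos hε)
    refine ⟨f '' Ici (max T T₁), image_mem_map (Ici_mem_atTop _), ?_⟩
    rintro _ ⟨s, hs, rfl⟩ _ ⟨s', hs', rfl⟩
    have hgs : ∀ u, max T T₁ ≤ u → |g u| < ε / 2 := fun u hu ↦ by
      have := hT₁ u ((le_max_right _ _).trans hu)
      rwa [Real.dist_eq, sub_zero] at this
    rcases le_total s s' with hss' | hss'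
    · have := h s s' ((le_max_left _ _).trans hs) hss'
      rw [Real.dist_eq, abs_sub_comm]
      linarith [hgs s hs, le_abs_self (g s)]
    · have := h s' s ((le_max_left _ _).trans hs') hss'
      rw [Real.dist_eq]
      linarith [hgs s' hs', le_abs_self (g s')]
  obtain ⟨L, hL⟩ := cauchy_map_iff_exists_tendsto.mp hc
  exact ⟨L, hL⟩

/-! ### The impulse integral at linear scale -/

/-- `∫_{t₁}^{t₂} s^{-3/2} ds ≤ 2 t₁^{-1/2}` for `0 < t₁ ≤ t₂`. [folklore] -/
theorem integral_inv_rpow_three_halves_le {t₁ t₂ : ℝ} (ht₁ : 0 < t₁) (h : t₁ ≤ t₂) :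
    ∫ s in t₁..t₂, (s ^ (3 / 2 : ℝ))⁻¹ ≤ 2 * (t₁ ^ (1 / 2 : ℝ))⁻¹ := by
  have ht₂ : 0 < t₂ := ht₁.trans_le h
  have hcalc : ∫ s in t₁..t₂, (s ^ (3 / 2 : ℝ))⁻¹ = ∫ s in t₁..t₂, s ^ (-(3 / 2) : ℝ) := by
    refine integral_congr fun s hs ↦ ?_
    have hs0 : 0 < s := by
      rcases le_total t₁ t₂ with h' | h'
      · rw [uIcc_of_le h'] at hs; exact ht₁.trans_le hs.1
      · rw [uIcc_of_ge h'] at hs; exact ht₂.trans_le hs.1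
    rw [Real.rpow_neg hs0.le]
  rw [hcalc, integral_rpow (Or.inr ⟨by norm_num, Set.notMem_uIcc_of_lt ht₁ ht₂⟩)]
  have e1 : (-(3 / 2) : ℝ) + 1 = -(1 / 2) := by norm_num
  rw [e1]
  have hp1 : t₁ ^ (-(1 / 2) : ℝ) = (t₁ ^ (1 / 2 : ℝ))⁻¹ := Real.rpow_neg ht₁.le _
  have hp2 : 0 ≤ t₂ ^ (-(1 / 2) : ℝ) := Real.rpow_nonneg ht₂.le _
  rw [hp1]
  have : (t₂ ^ (-(1 / 2) : ℝ) - (t₁ ^ (1 / 2 : ℝ))⁻¹) / (-(1 / 2) : ℝ)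
      = 2 * (t₁ ^ (1 / 2 : ℝ))⁻¹ - 2 * t₂ ^ (-(1 / 2) : ℝ) := by ring
  rw [this]
  linarith

/-- Scaled version: `∫_{t₁}^{t₂} (c s)^{-3/2} ds ≤ 2 c^{-3/2} t₁^{-1/2}` for `0 < c`, `0 < t₁ ≤ t₂`. [folklore] -/
theorem integral_inv_rpow_three_halves_mul_le {c t₁ t₂ : ℝ} (hc : 0 < c) (ht₁ : 0 < t₁) (h : t₁ ≤ t₂) :
    ∫ s in t₁..t₂, ((c * s) ^ (3 / 2 : ℝ))⁻¹ ≤ 2 * (c ^ (3 / 2 : ℝ))⁻¹ * (t₁ ^ (1 / 2 : ℝ))⁻¹ := by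
  have hcalc : ∫ s in t₁..t₂, ((c * s) ^ (3 / 2 : ℝ))⁻¹
      = (c ^ (3 / 2 : ℝ))⁻¹ * ∫ s in t₁..t₂, (s ^ (3 / 2 : ℝ))⁻¹ := by
    rw [← intervalIntegral.integral_const_mul]
    refine integral_congr fun s hs ↦ ?_
    have hs0 : 0 ≤ s := by
      rw [uIcc_of_le h] at hs; exact ht₁.le.trans hs.1
    rw [Real.mul_rpow hc.le hs0, mul_inv]
  rw [hcalc]
  have hcp : 0 < (c ^ (3 / 2 : ℝ))⁻¹ := inv_pos.mpr (Real.rpow_pos_of_pos hc _)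
  calc (c ^ (3 / 2 : ℝ))⁻¹ * ∫ s in t₁..t₂, (s ^ (3 / 2 : ℝ))⁻¹
      ≤ (c ^ (3 / 2 : ℝ))⁻¹ * (2 * (t₁ ^ (1 / 2 : ℝ))⁻¹) :=
        mul_le_mul_of_nonneg_left (integral_inv_rpow_three_halves_le ht₁ h) hcp.le
    _ = 2 * (c ^ (3 / 2 : ℝ))⁻¹ * (t₁ ^ (1 / 2 : ℝ))⁻¹ := by ring

/-- `t₁^{-1/2} → 0`. [folklore] -/
theorem tendsto_inv_rpow_half : Tendsto (fun t : ℝ ↦ (t ^ (1 / 2 : ℝ))⁻¹) atTop (𝓝 0) := by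
  have h := (tendsto_rpow_atTop (show (0 : ℝ) < 1 / 2 by norm_num)).inv_tendsto_atTop
  exact h

/-! ### Componentwise convergence in `E3` -/

/-- The Euclidean norm on `E3` is bounded by the sum of the absolute values of the coordinates. [folklore] -/
theorem norm_le_sum_abs (x : E3) : ‖x‖ ≤ ∑ i, |x i| := by
  rw [EuclideanSpace.norm_eq]
  have h0 : ∀ i, 0 ≤ |x i| := fun i ↦ abs_nonneg _
  have hsq : ∑ i, ‖x i‖ ^ 2 ≤ (∑ i, |x i|) ^ 2 := by
    simp only [Real.norm_eq_abs]
    calc ∑ i, |x i| ^ 2 ≤ ∑ i, |x i| * ∑ j, |x j| := by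
          refine Finset.sum_le_sum fun i _ ↦ ?_
          rw [sq]
          exact mul_le_mul_of_nonneg_left (Finset.single_le_sum (fun j _ ↦ h0 j) (Finset.mem_univ i))
            (h0 i)
      _ = (∑ i, |x i|) ^ 2 := by rw [← Finset.sum_mul, sq]
  calc √(∑ i, ‖x i‖ ^ 2) ≤ √((∑ i, |x i|) ^ 2) := Real.sqrt_le_sqrt hsq
    _ = ∑ i, |x i| := Real.sqrt_sq (Finset.sum_nonneg fun i _ ↦ h0 i)

/-- Convergence in `E3` from convergence of the three coordinates. [folklore] -/
theorem tendsto_euclidean_of_forall_apply {α : Type*} {l : Filter α} {f : α → E3} {V : E3}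
    (h : ∀ i, Tendsto (fun a ↦ f a i) l (𝓝 (V i))) : Tendsto f l (𝓝 V) := by
  rw [tendsto_iff_norm_sub_tendsto_zero]
  have hsum : Tendsto (fun a ↦ ∑ i, |(f a - V) i|) l (𝓝 0) := by
    have : (fun a ↦ ∑ i, |(f a - V) i|) = fun a ↦ ∑ i, |f a i - V i| := by
      ext a; simp
    rw [this, show (0 : ℝ) = ∑ _i : Fin 3, (0 : ℝ) by simp]
    refine tendsto_finsetSum _ fun i _ ↦ ?_
    have := (tendsto_iff_norm_sub_tendsto_zero.mp (h i))
    simpa [Real.norm_eq_abs] using this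
  exact squeeze_zero (fun a ↦ norm_nonneg _) (fun a ↦ norm_le_sum_abs _) hsum

/-- Coordinates of a convergent `E3`-valued function converge. [folklore] -/
theorem tendsto_apply_of_tendsto_euclidean {α : Type*} {l : Filter α} {f : α → E3} {V : E3}
    (h : Tendsto f l (𝓝 V)) (i : Fin 3) : Tendsto (fun a ↦ f a i) l (𝓝 (V i)) :=
  ((EuclideanSpace.proj i).continuous.tendsto V).comp h

/-! ### Velocity from the energy–momentum pair -/

/-- The Lorentz factor is at least `1` for subluminal velocities. [folklore] -/
theorem one_le_inv_sqrt_one_sub_sq {v : E3} (hv : ‖v‖ < 1) : 1 ≤ (√(1 - ‖v‖ ^ 2))⁻¹ := by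
  have h1 : 0 < 1 - ‖v‖ ^ 2 := by nlinarith [norm_nonneg v]
  have h2 : √(1 - ‖v‖ ^ 2) ≤ 1 := by
    rw [Real.sqrt_le_one]
    nlinarith [norm_nonneg v]
  have h3 : 0 < √(1 - ‖v‖ ^ 2) := Real.sqrt_pos.mpr h1
  rw [le_inv_comm₀ one_pos h3, inv_one]
  exact h2

/-- RECOVERY OF THE VELOCITY: if `M > 0`, `‖v(t)‖ ≤ k < 1`, the energy `e(t) = Mγ(v(t))` tends to `E` and the
momentum components `e(t) v(t)_k` tend to `P_k`, then `v(t) → E⁻¹ • P` (and `E ≥ M > 0`). [folklore] -/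
theorem tendsto_velocity_of_charge {v : ℝ → E3} {M k E : ℝ} {P : E3} (hM : 0 < M) (hk : k < 1)
    (hvk : ∀ t, ‖v t‖ ≤ k)
    (hE : Tendsto (fun t ↦ M * (√(1 - ‖v t‖ ^ 2))⁻¹) atTop (𝓝 E))
    (hP : ∀ i : Fin 3, Tendsto (fun t ↦ M * (√(1 - ‖v t‖ ^ 2))⁻¹ * v t i) atTop (𝓝 (P i))) :
    M ≤ E ∧ Tendsto v atTop (𝓝 (E⁻¹ • P)) := by
  have hv1 : ∀ t, ‖v t‖ < 1 := fun t ↦ (hvk t).trans_lt hk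
  have hge : ∀ t, M ≤ M * (√(1 - ‖v t‖ ^ 2))⁻¹ := fun t ↦
    le_mul_of_one_le_right hM.le (one_le_inv_sqrt_one_sub_sq (hv1 t))
  have hME : M ≤ E := ge_of_tendsto hE (Eventually.of_forall hge)
  have hE0 : E ≠ 0 := (hM.trans_le hME).ne'
  refine ⟨hME, tendsto_euclidean_of_forall_apply fun i ↦ ?_⟩
  have he0 : ∀ t, M * (√(1 - ‖v t‖ ^ 2))⁻¹ ≠ 0 := fun t ↦ (hM.trans_le (hge t)).ne'
  have hq := (hP i).mul (hE.inv₀ hE0)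
  have hs0 : ∀ t, √(1 - ‖v t‖ ^ 2) ≠ 0 := fun t ↦
    (Real.sqrt_pos.mpr (by nlinarith [norm_nonneg (v t), hv1 t])).ne'
  have : (fun t ↦ M * (√(1 - ‖v t‖ ^ 2))⁻¹ * v t i * (M * (√(1 - ‖v t‖ ^ 2))⁻¹)⁻¹) = fun t ↦ v t i := by
    ext t
    field_simp [he0 t, hs0 t, hM.ne']
  rw [this] at hq
  simpa [mul_comm] using hq

/-! ### Charges along windows isolated at linear scale converge -/

/-- CHARGE CONVERGENCE AT LINEAR SCALE: if along a window path the charge increments are bounded by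
`C∫(R s)^{-3/2} ds` (the abstract window law) and the radius grows linearly, `R(s) ≥ c₀ s` with `c₀ > 0`
(`R` continuous), then every component of the charge converges as `t → ∞` (`∫^∞ s^{-3/2} < ∞`). [folklore] -/
theorem exists_tendsto_charge_of_linear_scale {Q : ℝ → Fin 4 → ℝ} {R : ℝ → ℝ} {C T c₀ : ℝ} (hT : 0 < T)
    (hc₀ : 0 < c₀) (hR : ContinuousOn R (Ici T)) (hRge : ∀ s, T ≤ s → c₀ * s ≤ R s)
    (hlaw : ∀ t₁ t₂, T ≤ t₁ → t₁ ≤ t₂ → ∀ μ, |Q t₂ μ - Q t₁ μ| ≤ C * ∫ s in t₁..t₂, (R s ^ (3 / 2 : ℝ))⁻¹) :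
    ∀ μ, ∃ L : ℝ, Tendsto (fun t ↦ Q t μ) atTop (𝓝 L) := by
  intro μ
  refine exists_tendsto_of_abs_sub_le (T := T)
    (g := fun t₁ ↦ |C| * (2 * (c₀ ^ (3 / 2 : ℝ))⁻¹ * (t₁ ^ (1 / 2 : ℝ))⁻¹)) ?_ fun t₁ t₂ ht₁ h12 ↦ ?_
  · have := (tendsto_inv_rpow_half.const_mul (2 * (c₀ ^ (3 / 2 : ℝ))⁻¹)).const_mul |C|
    simpa [mul_assoc] using this
  have ht₁0 : 0 < t₁ := hT.trans_le ht₁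
  have hRpos : ∀ s ∈ Icc t₁ t₂, 0 < R s := fun s hs ↦
    (mul_pos hc₀ (ht₁0.trans_le hs.1)).trans_le (hRge s (ht₁.trans hs.1))
  have hcontR : ContinuousOn (fun s ↦ (R s ^ (3 / 2 : ℝ))⁻¹) (Icc t₁ t₂) := by
    refine ContinuousOn.inv₀ ?_ fun s hs ↦ (Real.rpow_pos_of_pos (hRpos s hs) _).ne'
    exact (hR.mono fun s hs ↦ ht₁.trans hs.1).rpow_const fun s hs ↦ Or.inl (hRpos s hs).ne'
  have hcontc : ContinuousOn (fun s ↦ ((c₀ * s) ^ (3 / 2 : ℝ))⁻¹) (Icc t₁ t₂) := by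
    refine ContinuousOn.inv₀ ?_ fun s hs ↦
      (Real.rpow_pos_of_pos (mul_pos hc₀ (ht₁0.trans_le hs.1)) _).ne'
    exact (continuousOn_const.mul continuousOn_id).rpow_const fun s hs ↦
      Or.inl (mul_pos hc₀ (ht₁0.trans_le hs.1)).ne'
  have hmono : ∫ s in t₁..t₂, (R s ^ (3 / 2 : ℝ))⁻¹ ≤ ∫ s in t₁..t₂, ((c₀ * s) ^ (3 / 2 : ℝ))⁻¹ := by
    refine intervalIntegral.integral_mono_on h12 (hcontR.intervalIntegrable_of_Icc h12)
      (hcontc.intervalIntegrable_of_Icc h12) fun s hs ↦ ?_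
    have h1 : 0 < (c₀ * s) ^ (3 / 2 : ℝ) := Real.rpow_pos_of_pos (mul_pos hc₀ (ht₁0.trans_le hs.1)) _
    refine (inv_le_inv₀ (Real.rpow_pos_of_pos (hRpos s hs) _) h1).mpr ?_
    exact Real.rpow_le_rpow (mul_pos hc₀ (ht₁0.trans_le hs.1)).le (hRge s (ht₁.trans hs.1))
      (by norm_num)
  have hnn : 0 ≤ ∫ s in t₁..t₂, (R s ^ (3 / 2 : ℝ))⁻¹ :=
    intervalIntegral.integral_nonneg h12 fun s hs ↦ (inv_pos.mpr (Real.rpow_pos_of_pos (hRpos s hs) _)).le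
  calc |Q t₂ μ - Q t₁ μ| ≤ C * ∫ s in t₁..t₂, (R s ^ (3 / 2 : ℝ))⁻¹ := hlaw t₁ t₂ ht₁ h12 μ
    _ ≤ |C| * ∫ s in t₁..t₂, (R s ^ (3 / 2 : ℝ))⁻¹ := mul_le_mul_of_nonneg_right (le_abs_self C) hnn
    _ ≤ |C| * ∫ s in t₁..t₂, ((c₀ * s) ^ (3 / 2 : ℝ))⁻¹ := mul_le_mul_of_nonneg_left hmono (abs_nonneg C)
    _ ≤ |C| * (2 * (c₀ ^ (3 / 2 : ℝ))⁻¹ * (t₁ ^ (1 / 2 : ℝ))⁻¹) :=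
        mul_le_mul_of_nonneg_left (integral_inv_rpow_three_halves_mul_le hc₀ ht₁0 h12) (abs_nonneg C)

/-! ### Identified charges: convergence of the velocity -/

/-- A real path eventually within `ζ(t) → 0` of a convergent path has the same limit. [folklore] -/
theorem tendsto_of_abs_sub_le_of_tendsto {f g ζ : ℝ → ℝ} {L T : ℝ} (hf : Tendsto f atTop (𝓝 L))
    (hζ : Tendsto ζ atTop (𝓝 0)) (hfg : ∀ t, T ≤ t → |f t - g t| ≤ ζ t) :
    Tendsto g atTop (𝓝 L) := by
  have hζ' : Tendsto (fun t ↦ |ζ t|) atTop (𝓝 0) := by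
    have h := (continuous_abs.tendsto (0 : ℝ)).comp hζ
    rw [abs_zero] at h
    exact h
  have hdiff : Tendsto (fun t ↦ f t - g t) atTop (𝓝 0) := by
    refine squeeze_zero_norm' ?_ hζ'
    filter_upwards [eventually_ge_atTop T] with t ht
    simpa [Real.norm_eq_abs] using (hfg t ht).trans (le_abs_self (ζ t))
  have := hf.sub hdiff
  simpa using this

/-- IDENTIFIED CHARGE ⇒ CONVERGENT VELOCITY: if the energy and momentum charges `Q⁰(t)`, `Qᵏ(t)` of a single hole
converge, and they are identified with `Mγ(v(t))` and `Mγ(v(t))v(t)ᵏ` up to `ζ(t) → 0` after time `T`, with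
`M > 0` and `‖v‖ ≤ k < 1`, then `v(t)` converges. [folklore] -/
theorem exists_tendsto_velocity_of_identified {Q : ℝ → Fin 4 → ℝ} {v : ℝ → E3} {ζ : ℝ → ℝ} {M k T : ℝ}
    (hM : 0 < M) (hk : k < 1) (hvk : ∀ t, ‖v t‖ ≤ k) (hζ : Tendsto ζ atTop (𝓝 0))
    (hQ : ∀ μ, ∃ L : ℝ, Tendsto (fun t ↦ Q t μ) atTop (𝓝 L))
    (hid0 : ∀ t, T ≤ t → |Q t 0 - M * (√(1 - ‖v t‖ ^ 2))⁻¹| ≤ ζ t)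
    (hidk : ∀ t, T ≤ t → ∀ i : Fin 3, |Q t i.succ - M * (√(1 - ‖v t‖ ^ 2))⁻¹ * v t i| ≤ ζ t) :
    ∃ V : E3, Tendsto v atTop (𝓝 V) := by
  choose L hL using hQ
  have hE : Tendsto (fun t ↦ M * (√(1 - ‖v t‖ ^ 2))⁻¹) atTop (𝓝 (L 0)) :=
    tendsto_of_abs_sub_le_of_tendsto (hL 0) hζ hid0
  have hP : ∀ i : Fin 3, Tendsto (fun t ↦ M * (√(1 - ‖v t‖ ^ 2))⁻¹ * v t i) atTop (𝓝 (L i.succ)) :=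
    fun i ↦ tendsto_of_abs_sub_le_of_tendsto (hL i.succ) hζ fun t ht ↦ hidk t ht i
  let P : E3 := WithLp.toLp 2 fun i ↦ L i.succ
  have hP' : ∀ i : Fin 3, Tendsto (fun t ↦ M * (√(1 - ‖v t‖ ^ 2))⁻¹ * v t i) atTop (𝓝 (P i)) := by
    intro i; simpa [P] using hP i
  exact ⟨(L 0)⁻¹ • P, (tendsto_velocity_of_charge hM hk hvk hE hP').2⟩

/-- Registered helper form (verbatim signature) of `exists_tendsto_charge_of_linear_scale`: charge convergence at linear
scale. [folklore] -/
theorem endgame_chargeConvergence_of_linear_scale : open Filter Topology in ∀ (Q : ℝ → Fin 4 → ℝ) (R : ℝ → ℝ) (C T c₀ : ℝ), 0 < T → 0 < c₀ → ContinuousOn R (Set.Ici T) → (∀ s, T ≤ s → c₀ * s ≤ R s) → (∀ t₁ t₂, T ≤ t₁ → t₁ ≤ t₂ → ∀ μ, |Q t₂ μ - Q t₁ μ| ≤ C * ∫ s in t₁..t₂, (R s ^ (3 / 2 : ℝ))⁻¹) → ∀ μ, ∃ L : ℝ, Tendsto (fun t ↦ Q t μ) atTop (𝓝 L) :=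
  fun _ _ _ _ _ hT hc₀ hR hRge hlaw ↦ exists_tendsto_charge_of_linear_scale hT hc₀ hR hRge hlaw

end Summit.FinalStateConjecture.FinalStateConjecture.Theorems.SublinearIsFree.Endgame

end
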